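import Literature.NumberTheory.EllipticCurves.DescendedFrobeniusMatrix
import Summits.BirchSwinnertonDyer.BirchSwinnertonDyer.Theorems.CyclotomicUntwistSecondKindLogClasses
import Summits.BirchSwinnertonDyer.BirchSwinnertonDyer.Theorems.CyclotomicUntwistDescendedFrobeniusRational
import Mathlib.RingTheory.Trace.Basic
import Mathlib.RingTheory.IntegralClosure.IntegrallyClosed
import Mathlib.RingTheory.Localization.Integral
import HarnessLib

/-!
# Route `CyclotomicUntwist`: the Berthelot–Ogus TRANSFER basis in the currency of
# `Literature.DescendedFrobeniusMatrix` — independence in `ℚ₃(ζ₉)⟦X⟧` via the trace form, the Frobenius powers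
# `z ↦ z⁹`, `z ↦ z²⁷` as `C²`, `C³` on it (toolkit for `IsDescendedFrobeniusMatrix ⟸ transfer coordinates`)

Cell `pub/bsd-wall` (D-0145 line `route-BirchSwinnertonDyer-CyclotomicUntwist`), prover seat `bsd-line-cycu-p2`
(gen 6), lane «D5». THEOREMS ONLY (no definition, no named fact, no `sorry`); helper `--supports` K1 =
stmt-BirchSwinnertonDyer-21580 (serves K2 = 21581 and the print child C2 = 27549 equally). BSD is not proved by this
file and no crux is. Currency: `KNine = ℚ₃(ζ₉)`, `ONine`, `HasBoundedDenominators`, `NineGoodModel`,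
`IsPowerMapMatrix`, `ClassesIndependent`, `IsDescendedFrobeniusMatrix` of the ADOPTED Literature definition (p623342,
typer bsd-stepL-lit g36); the source side is this seat's `CyclotomicUntwistSecondKindLogClasses` (p625622).

THE POINT. The Literature predicate pins `M` through the power maps `z ↦ z⁹ = φ²`, `z ↦ z²⁷ = φ³` on the good
model's own classes and carries `ClassesIndependent` and the existence-with-trace as the named fact
`isDescendedFrobeniusMatrix_exists`. The Berthelot–Ogus comparison behind that fact is the TRANSFER
`Ψ[f] = [f(z⁹)]` from Katz's module of a `ℤ₃`-lift (memo `D5-TYPING-v1.md` §2): the classes of the good model are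
`L`-combinations of `ℓ₀ := log₀(z⁹)`, `ℓ₁ := log₀(z²⁷)` for a supersingular Honda logarithm `log₀ ∈ ℚ₃⟦z⟧` (type
`3 − tT + T²`, `‖t‖ ≤ 3⁻¹`). This file proves, in the Literature currency:

* §1–§2 bounded-denominator toolkit over `ℚ₃(ζ₉)` (scalars, `expand`, import of `ℚ₃`-series with a norm bound) and the
  TRACE-FORM transfer: `y` integral, `3ᵈx` integral ⟹ `‖tr(yx)‖₃ ≤ 3ᵈ` (`norm_trace_mul_le`);
* §3 **`eq_zero_of_hbd_combination`: `a·ℓ₀ + b·ℓ₁` has bounded denominators in `ℚ₃(ζ₉)⟦z⟧ only for `a = b = 0`**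
  — the rank-2 / `ClassesIndependent` content for the transfer basis, with NO named fact: apply `tr(y·)` to land in
  `ℚ₃⟦z⟧`, use `SecondKindLogClasses.eq_zero_of_norm_coeff_combination_le`, conclude by non-degeneracy of the trace form;
* §4 the Frobenius powers on the transfer basis modulo bounded denominators: `ℓ₀(z⁹) ≡ −3ℓ₀ + tℓ₁`,
  `ℓ₁(z⁹) ≡ −3tℓ₀ + (t² − 3)ℓ₁` (= `C²`), `ℓ₀(z²⁷) ≡ −3tℓ₀ + (t² − 3)ℓ₁`, `ℓ₁(z²⁷) ≡ (9 − 3t²)ℓ₀ + (t³ − 6t)ℓ₁` (= `C³`),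
  `C = !![0, −3; 1, t]`, from the Honda relation `log₀(z⁹) − t·log₀(z³) + 3·log₀ ≡ 0`;
* the sequel `CyclotomicUntwistDescendedFrobeniusTransferReduction` concludes: transfer coordinates for every good
  model, intertwining one rational `M`, give `W.IsDescendedFrobeniusMatrix M` (ClassesIndependent and both power-map
  clauses as THEOREMS), `tr M = t`, `M₁₀ ≠ 0`.
[cite: Katz1981CrystallineDieudonne, §5 Thm 5.1.4] [cite: BerthelotOgus1983, Thm. 2.4] [cite: Honda1970, Thm. 9]
-/

set_option autoImplicit false
-- single-conjunct summit: `Summit.BirchSwinnertonDyer.BirchSwinnertonDyer.…` repeats the name by design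
set_option linter.dupNamespace false

noncomputable section

open PowerSeries Literature.RingTheory.FormalGroups Literature.NumberTheory.EllipticCurves.DescendedFrobenius

namespace Summit.BirchSwinnertonDyer.BirchSwinnertonDyer.Theorems.DescendedFrobeniusTransfer

/-! ## §1 Bounded denominators over `ℚ₃(ζ₉)`: scalars, `expand`, import from `ℚ₃` -/

/-- `ℚ₃(ζ₉)` is finite-dimensional over `ℚ₃`. [folklore] -/
theorem finiteDimensional_KNine : FiniteDimensional ℚ_[3] KNine :=
  IsCyclotomicExtension.finiteDimensional {9} ℚ_[3] KNine

/-- Every element of `ℚ₃(ζ₉)` becomes `ℤ₃`-integral after multiplication by a power of `3`. [folklore] -/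
theorem exists_three_pow_mul_isIntegral (c : KNine) : ∃ k : ℕ, IsIntegral ℤ_[3] ((3 : KNine) ^ k * c) := by
  haveI := finiteDimensional_KNine
  have hc : IsIntegral ℚ_[3] c := Algebra.IsIntegral.isIntegral c
  obtain ⟨⟨m, hm⟩, hint⟩ :=
    IsIntegral.exists_multiple_integral_of_isLocalization (nonZeroDivisors ℤ_[3]) c hc
  have hm0 : m ≠ 0 := nonZeroDivisors.ne_zero hm
  refine ⟨m.valuation, ?_⟩
  have hu := PadicInt.unitCoeff_spec hm0
  set u := PadicInt.unitCoeff hm0 with hudef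
  -- `3^k • c = u⁻¹ • (m • c)`
  have e : (3 : KNine) ^ m.valuation * c = algebraMap ℤ_[3] KNine ((u⁻¹ : ℤ_[3]ˣ) : ℤ_[3]) * (m • c) := by
    rw [Algebra.smul_def]
    change (3 : KNine) ^ m.valuation * c = algebraMap ℤ_[3] KNine ((u⁻¹ : ℤ_[3]ˣ) : ℤ_[3]) *
      (algebraMap ℤ_[3] KNine m * c)
    conv_rhs => rw [hu]
    rw [map_mul, map_pow, map_natCast, ← mul_assoc, ← mul_assoc, ← map_mul, Units.inv_mul, map_one, one_mul]
    norm_num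
  rw [e]
  exact isIntegral_algebraMap.mul hint

/-- **Scalars preserve bounded denominators**: `c·f` has bounded denominators if `f` does (`c ∈ ℚ₃(ζ₉)`).
[cite: Katz1981CrystallineDieudonne, §5.1 (p. 193)] -/
theorem hbd_C_mul (c : KNine) {f : KNine⟦X⟧} (hf : HasBoundedDenominators f) :
    HasBoundedDenominators (PowerSeries.C c * f) := by
  obtain ⟨d, hd⟩ := hf
  obtain ⟨k, hk⟩ := exists_three_pow_mul_isIntegral c
  refine ⟨k + d, fun n ↦ ?_⟩
  rw [coeff_C_mul, show (3 : KNine) ^ (k + d) * (c * coeff n f) = (3 ^ k * c) * (3 ^ d * coeff n f) by ring]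
  exact hk.mul (hd n)

/-- The `•` form. [cite: Katz1981CrystallineDieudonne, §5.1 (p. 193)] -/
theorem hbd_smul (c : KNine) {f : KNine⟦X⟧} (hf : HasBoundedDenominators f) :
    HasBoundedDenominators (c • f) := by
  rw [smul_eq_C_mul]; exact hbd_C_mul c hf

/-- **`expand` preserves bounded denominators** (the coefficients of `f(z^q)` are those of `f` or `0`). [folklore] -/
theorem hbd_expand (q : ℕ) (hq : q ≠ 0) {f : KNine⟦X⟧} (hf : HasBoundedDenominators f) :
    HasBoundedDenominators (expand q hq f) := by
  obtain ⟨d, hd⟩ := hf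
  refine ⟨d, fun n ↦ ?_⟩
  rw [coeff_expand]
  split_ifs
  · exact hd _
  · rw [mul_zero]; exact isIntegral_zero

/-- **Import from `ℚ₃`**: a `ℚ₃`-series with `‖[zⁿ]g‖ ≤ 3ᵈ` has bounded denominators in `ℚ₃(ζ₉)⟦z⟧`. [folklore] -/
theorem hbd_map_of_norm_le {g : ℚ_[3]⟦X⟧} {d : ℕ} (h : ∀ n, ‖coeff n g‖ ≤ (3 : ℝ) ^ d) :
    HasBoundedDenominators (g.map (algebraMap ℚ_[3] KNine)) := by
  refine ⟨d, fun n ↦ ?_⟩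
  rw [coeff_map]
  have h3 : ‖(3 : ℚ_[3]) ^ d * coeff n g‖ ≤ 1 := by
    rw [norm_mul, norm_pow]
    have : ‖(3 : ℚ_[3])‖ = (3 : ℝ)⁻¹ := by exact_mod_cast Padic.norm_p (p := 3)
    rw [this, inv_pow]
    calc ((3 : ℝ) ^ d)⁻¹ * ‖coeff n g‖ ≤ ((3 : ℝ) ^ d)⁻¹ * (3 : ℝ) ^ d := by gcongr; exact h n
      _ = 1 := inv_mul_cancel₀ (by positivity)
  set x : ℤ_[3] := ⟨(3 : ℚ_[3]) ^ d * coeff n g, h3⟩ with hx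
  have e : (3 : KNine) ^ d * algebraMap ℚ_[3] KNine (coeff n g) = algebraMap ℤ_[3] KNine x := by
    rw [IsScalarTower.algebraMap_apply ℤ_[3] ℚ_[3] KNine, hx]
    change (3 : KNine) ^ d * algebraMap ℚ_[3] KNine (coeff n g) = algebraMap ℚ_[3] KNine ((3 : ℚ_[3]) ^ d * coeff n g)
    rw [map_mul, map_pow, map_ofNat]
  rw [e]; exact isIntegral_algebraMap

/-! ## §2 The trace-form transfer `ℚ₃(ζ₉) → ℚ₃` -/

/-- **`‖tr(y·x)‖₃ ≤ 3ᵈ` for `y` integral and `3ᵈx` integral**: `tr(y·3ᵈx)` is an integral element of `ℚ₃`,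
i.e. lies in `ℤ₃`. [folklore] -/
theorem norm_trace_mul_le {y x : KNine} {d : ℕ} (hy : IsIntegral ℤ_[3] y) (hx : IsIntegral ℤ_[3] ((3 : KNine) ^ d * x)) :
    ‖Algebra.trace ℚ_[3] KNine (y * x)‖ ≤ (3 : ℝ) ^ d := by
  haveI := finiteDimensional_KNine
  have hint : IsIntegral ℤ_[3] (Algebra.trace ℚ_[3] KNine (y * ((3 : KNine) ^ d * x))) :=
    Algebra.isIntegral_trace (hy.mul hx)
  obtain ⟨z, hz⟩ := IsIntegrallyClosed.algebraMap_eq_of_integral hint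
  have e : Algebra.trace ℚ_[3] KNine (y * ((3 : KNine) ^ d * x)) = (3 : ℚ_[3]) ^ d * Algebra.trace ℚ_[3] KNine (y * x) := by
    rw [show y * ((3 : KNine) ^ d * x) = ((3 : ℚ_[3]) ^ d) • (y * x) by
      rw [Algebra.smul_def, map_pow, map_ofNat]; ring, map_smul, smul_eq_mul]
  rw [e] at hz
  have hz1 : ‖(3 : ℚ_[3]) ^ d * Algebra.trace ℚ_[3] KNine (y * x)‖ ≤ 1 := by
    rw [← hz]; exact PadicInt.norm_le_one z
  rw [norm_mul, norm_pow] at hz1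
  have h3 : ‖(3 : ℚ_[3])‖ = (3 : ℝ)⁻¹ := by exact_mod_cast Padic.norm_p (p := 3)
  rw [h3, inv_pow] at hz1
  have hpos : (0 : ℝ) < (3 : ℝ) ^ d := by positivity
  calc ‖Algebra.trace ℚ_[3] KNine (y * x)‖ = (3 : ℝ) ^ d * (((3 : ℝ) ^ d)⁻¹ * ‖Algebra.trace ℚ_[3] KNine (y * x)‖) := by
        rw [← mul_assoc, mul_inv_cancel₀ hpos.ne', one_mul]
    _ ≤ (3 : ℝ) ^ d * 1 := by gcongr
    _ = (3 : ℝ) ^ d := mul_one _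

/-- **Non-degeneracy against integral elements**: if `tr(y·a) = 0` for every `ℤ₃`-integral `y ∈ ℚ₃(ζ₉)` then `a = 0`
(every `y` is `3⁻ᵏ` times an integral element; the trace form of the separable extension `ℚ₃(ζ₉)/ℚ₃` is
non-degenerate). [folklore] -/
theorem eq_zero_of_trace_mul_integral {a : KNine} (h : ∀ y : KNine, IsIntegral ℤ_[3] y → Algebra.trace ℚ_[3] KNine (y * a) = 0) :
    a = 0 := by
  haveI := finiteDimensional_KNine
  haveI := IsCyclotomicExtension.isSeparable {9} ℚ_[3] KNine
  have hnd := (traceForm_nondegenerate ℚ_[3] KNine).1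
  refine hnd a fun y ↦ ?_
  rw [Algebra.traceForm_apply]
  obtain ⟨k, hk⟩ := exists_three_pow_mul_isIntegral y
  have h1 := h _ hk
  have e : (3 : KNine) ^ k * y * a = ((3 : ℚ_[3]) ^ k) • (a * y) := by
    rw [Algebra.smul_def, map_pow, map_ofNat]; ring
  rw [e, map_smul, smul_eq_zero] at h1
  exact h1.resolve_left (pow_ne_zero k (by norm_num))

/-- The trace functional `tr(y·)` commutes with `ℚ₃`-coefficients: `tr(y·(a·ι r + b·ι s)) = tr(ya)·r + tr(yb)·s`.
[folklore] -/
theorem trace_mul_combination (y a b : KNine) (r s : ℚ_[3]) :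
    Algebra.trace ℚ_[3] KNine (y * (a * algebraMap ℚ_[3] KNine r + b * algebraMap ℚ_[3] KNine s)) =
      Algebra.trace ℚ_[3] KNine (y * a) * r + Algebra.trace ℚ_[3] KNine (y * b) * s := by
  have e : y * (a * algebraMap ℚ_[3] KNine r + b * algebraMap ℚ_[3] KNine s) = r • (y * a) + s • (y * b) := by
    rw [Algebra.smul_def, Algebra.smul_def]; ring
  rw [e, map_add, map_smul, map_smul, smul_eq_mul, smul_eq_mul]; ring

/-! ## §3 Independence of the transfer basis `(log₀(z⁹), log₀(z²⁷))` in `ℚ₃(ζ₉)⟦z⟧` -/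

/-- The coefficient of `z^n` of `a·ℓ(z⁹) + b·ℓ(z²⁷)` read in `ℚ₃(ζ₉)` (`ℓ ∈ ℚ₃⟦z⟧`). [folklore] -/
theorem coeff_combination (ℓ : ℚ_[3]⟦X⟧) (a b : KNine) (n : ℕ) :
    coeff n (PowerSeries.C a * expand 9 (by norm_num) (ℓ.map (algebraMap ℚ_[3] KNine)) +
        PowerSeries.C b * expand 27 (by norm_num) (ℓ.map (algebraMap ℚ_[3] KNine))) =
      a * algebraMap ℚ_[3] KNine (coeff n (expand 9 (by norm_num) ℓ)) +
        b * algebraMap ℚ_[3] KNine (coeff n (expand 27 (by norm_num) ℓ)) := by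
  rw [map_add, coeff_C_mul, coeff_C_mul, ← map_expand, ← map_expand, coeff_map, coeff_map]

/-- **INDEPENDENCE (the `ClassesIndependent` content for the transfer basis, no named fact).** For a supersingular
Honda logarithm `ℓ ∈ ℚ₃⟦z⟧` (`[z¹]ℓ = 1`, type `3 − tT + T²`, `‖t‖ ≤ 3⁻¹`) and `a, b ∈ ℚ₃(ζ₉)`: if
`a·ℓ(z⁹) + b·ℓ(z²⁷)` has bounded denominators then `a = b = 0`. Proof: for each integral `y` the `ℚ₃`-series
`tr(ya)·ℓ(z⁹) + tr(yb)·ℓ(z²⁷) = (tr(ya)·ℓ + tr(yb)·ℓ(z³))(z⁹)` has coefficients of norm `≤ 3ᵈ` (`norm_trace_mul_le`), so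
`tr(ya) = tr(yb) = 0` (`SecondKindLogClasses.eq_zero_of_norm_coeff_combination_le` after `norm_coeff_le_of_expand`);
then `a = b = 0` by `eq_zero_of_trace_mul_integral`. [cite: Katz1981CrystallineDieudonne, Thm. 5.3.3]
[cite: Honda1970, Thm. 9] -/
theorem eq_zero_of_hbd_combination {t : ℚ_[3]} (ht : ‖t‖ ≤ ((3 : ℕ) : ℝ)⁻¹) {ℓ : ℚ_[3]⟦X⟧} (h1 : coeff 1 ℓ = 1)
    (hT : ∀ n, ‖coeff n (hondaShift 3 t ℓ)‖ ≤ 1) {a b : KNine}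
    (h : HasBoundedDenominators (PowerSeries.C a * expand 9 (by norm_num) (ℓ.map (algebraMap ℚ_[3] KNine)) +
      PowerSeries.C b * expand 27 (by norm_num) (ℓ.map (algebraMap ℚ_[3] KNine)))) :
    a = 0 ∧ b = 0 := by
  obtain ⟨d, hd⟩ := h
  -- for every integral `y`, the traced combination is a bounded `ℚ₃`-series, hence trivial
  have key : ∀ y : KNine, IsIntegral ℤ_[3] y →
      Algebra.trace ℚ_[3] KNine (y * a) = 0 ∧ Algebra.trace ℚ_[3] KNine (y * b) = 0 := by
    intro y hy
    set r := Algebra.trace ℚ_[3] KNine (y * a) with hr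
    set s := Algebra.trace ℚ_[3] KNine (y * b) with hs
    have h27 : expand 27 (by norm_num) ℓ = expand 9 (by norm_num) (expand 3 (prime_ne_zero 3) ℓ) := by
      rw [← expand_mul]
    -- the bound on the coefficients of `r·ℓ(z⁹) + s·ℓ(z²⁷) = (r·ℓ + s·ℓ(z³))(z⁹)`
    have hb : ∀ n, ‖coeff n (expand 9 (by norm_num) (PowerSeries.C r * ℓ.map (algebraMap ℚ_[3] ℚ_[3]) +
        PowerSeries.C s * expand 3 (prime_ne_zero 3) (ℓ.map (algebraMap ℚ_[3] ℚ_[3]))))‖ ≤ (3 : ℝ) ^ d := by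
      intro n
      have hmapid : ℓ.map (algebraMap ℚ_[3] ℚ_[3]) = ℓ := by
        rw [Algebra.algebraMap_self, PowerSeries.map_id]; rfl
      rw [hmapid, map_add, map_mul, map_mul, expand_C, expand_C, ← h27]
      have e : coeff n (PowerSeries.C r * expand 9 (by norm_num) ℓ + PowerSeries.C s * expand 27 (by norm_num) ℓ) =
          Algebra.trace ℚ_[3] KNine (y * coeff n (PowerSeries.C a * expand 9 (by norm_num) (ℓ.map (algebraMap ℚ_[3] KNine)) +
            PowerSeries.C b * expand 27 (by norm_num) (ℓ.map (algebraMap ℚ_[3] KNine)))) := by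
        rw [coeff_combination, trace_mul_combination, map_add, coeff_C_mul, coeff_C_mul]
      rw [e]
      exact norm_trace_mul_le hy (hd n)
    have hb' := SecondKindLogClasses.norm_coeff_le_of_expand (K := ℚ_[3]) (by norm_num : (9 : ℕ) ≠ 0) hb
    exact SecondKindLogClasses.eq_zero_of_norm_coeff_combination_le (K := ℚ_[3]) ht h1 hT hb'
  exact ⟨eq_zero_of_trace_mul_integral fun y hy ↦ (key y hy).1,
    eq_zero_of_trace_mul_integral fun y hy ↦ (key y hy).2⟩


/-! ## §4 The Frobenius powers `z ↦ z⁹`, `z ↦ z²⁷` on the transfer basis, modulo bounded denominators -/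

/-- `expand a ∘ expand b = expand (a·b)` with a prescribed name for the product. [folklore] -/
theorem expand_expand {R : Type*} [CommRing R] {a b c : ℕ} (ha : a ≠ 0) (hb : b ≠ 0) (hc : c ≠ 0)
    (h : a * b = c) (f : R⟦X⟧) : expand a ha (expand b hb f) = expand c hc f := by
  subst h
  exact (expand_mul a ha b hb f).symm

/-- **The Honda relation read in `ℚ₃(ζ₉)⟦z⟧`**: `L(z⁹) − t·L(z³) + 3·L` has bounded denominators
(`L = ℓ` mapped to `ℚ₃(ζ₉)`; its coefficients have norm `≤ 3⁻¹` by `SecondKindLogClasses.norm_coeff_frobenius_relation_le`).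
[cite: Honda1970, Thm. 9] -/
theorem hbd_hondaRelation {t : ℚ_[3]} {ℓ : ℚ_[3]⟦X⟧} (hT : ∀ n, ‖coeff n (hondaShift 3 t ℓ)‖ ≤ 1) :
    HasBoundedDenominators (expand 9 (by norm_num) (ℓ.map (algebraMap ℚ_[3] KNine)) -
      PowerSeries.C (algebraMap ℚ_[3] KNine t) * expand 3 (prime_ne_zero 3) (ℓ.map (algebraMap ℚ_[3] KNine)) +
      3 * ℓ.map (algebraMap ℚ_[3] KNine)) := by
  have h := hbd_map_of_norm_le (d := 0) (g := expand (3 ^ 2) (prime_sq_ne_zero 3) ℓ -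
      PowerSeries.C t * expand 3 (prime_ne_zero 3) ℓ + PowerSeries.C ((3 : ℕ) : ℚ_[3]) * ℓ) (fun n ↦ ?_)
  · have e : (expand (3 ^ 2) (prime_sq_ne_zero 3) ℓ - PowerSeries.C t * expand 3 (prime_ne_zero 3) ℓ +
        PowerSeries.C ((3 : ℕ) : ℚ_[3]) * ℓ).map (algebraMap ℚ_[3] KNine) =
        expand 9 (by norm_num) (ℓ.map (algebraMap ℚ_[3] KNine)) -
          PowerSeries.C (algebraMap ℚ_[3] KNine t) * expand 3 (prime_ne_zero 3) (ℓ.map (algebraMap ℚ_[3] KNine)) +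
          3 * ℓ.map (algebraMap ℚ_[3] KNine) := by
      rw [map_add, map_sub, map_mul, map_mul, map_C, map_C, map_expand, map_expand, map_natCast, map_natCast]
      rfl
    rwa [e] at h
  · rw [pow_zero]
    exact le_trans (SecondKindLogClasses.norm_coeff_frobenius_relation_le hT n)
      (inv_le_one_of_one_le₀ (by norm_num))

/-- **`φ²` and `φ³` on the transfer basis.** With `L = ℓ` over `ℚ₃(ζ₉)`, `ℓ₀ = L(z⁹)`, `ℓ₁ = L(z²⁷)`, `t′ = t`:
`ℓ₀(z⁹) ≡ t′ℓ₁ − 3ℓ₀`, `ℓ₁(z⁹) ≡ (t′² − 3)ℓ₁ − 3t′ℓ₀`, `ℓ₀(z²⁷) ≡ (t′² − 3)ℓ₁ − 3t′ℓ₀`,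
`ℓ₁(z²⁷) ≡ (t′³ − 6t′)ℓ₁ + (9 − 3t′²)ℓ₀` modulo bounded denominators — the companion matrix `C = !![0,−3;1,t]`
squared and cubed. [cite: Katz1981CrystallineDieudonne, §5 Thm 5.1.4] [cite: Honda1970, Thm. 9] -/
theorem hbd_frobenius_powers {t : ℚ_[3]} {ℓ : ℚ_[3]⟦X⟧} (hT : ∀ n, ‖coeff n (hondaShift 3 t ℓ)‖ ≤ 1) :
    let L := ℓ.map (algebraMap ℚ_[3] KNine)
    let tK := algebraMap ℚ_[3] KNine t
    HasBoundedDenominators (expand 9 (by norm_num) (expand 9 (by norm_num) L) -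
        (PowerSeries.C tK * expand 27 (by norm_num) L + PowerSeries.C (-3) * expand 9 (by norm_num) L)) ∧
      HasBoundedDenominators (expand 9 (by norm_num) (expand 27 (by norm_num) L) -
        (PowerSeries.C (tK ^ 2 - 3) * expand 27 (by norm_num) L + PowerSeries.C (-3 * tK) * expand 9 (by norm_num) L)) ∧
      HasBoundedDenominators (expand 27 (by norm_num) (expand 9 (by norm_num) L) -
        (PowerSeries.C (tK ^ 2 - 3) * expand 27 (by norm_num) L + PowerSeries.C (-3 * tK) * expand 9 (by norm_num) L)) ∧
      HasBoundedDenominators (expand 27 (by norm_num) (expand 27 (by norm_num) L) -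
        (PowerSeries.C (tK ^ 3 - 6 * tK) * expand 27 (by norm_num) L +
          PowerSeries.C (9 - 3 * tK ^ 2) * expand 9 (by norm_num) L)) := by
  intro L tK
  have R := hbd_hondaRelation hT
  change HasBoundedDenominators (expand 9 _ L - PowerSeries.C tK * expand 3 _ L + 3 * L) at R
  -- push the relation along `expand 3^k`
  have R9 : HasBoundedDenominators (expand 81 (by norm_num) L - PowerSeries.C tK * expand 27 (by norm_num) L +
      3 * expand 9 (by norm_num) L) := by
    have h := hbd_expand 9 (by norm_num) R
    rwa [map_add, map_sub, map_mul, map_mul, expand_C, map_ofNat,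
      expand_expand _ _ (by norm_num : (81 : ℕ) ≠ 0) (by norm_num) L,
      expand_expand _ _ (by norm_num : (27 : ℕ) ≠ 0) (by norm_num) L] at h
  have R27 : HasBoundedDenominators (expand 243 (by norm_num) L - PowerSeries.C tK * expand 81 (by norm_num) L +
      3 * expand 27 (by norm_num) L) := by
    have h := hbd_expand 27 (by norm_num) R
    rwa [map_add, map_sub, map_mul, map_mul, expand_C, map_ofNat,
      expand_expand _ _ (by norm_num : (243 : ℕ) ≠ 0) (by norm_num) L,
      expand_expand _ _ (by norm_num : (81 : ℕ) ≠ 0) (by norm_num) L] at h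
  have R81 : HasBoundedDenominators (expand 729 (by norm_num) L - PowerSeries.C tK * expand 243 (by norm_num) L +
      3 * expand 81 (by norm_num) L) := by
    have h := hbd_expand 81 (by norm_num) R
    rwa [map_add, map_sub, map_mul, map_mul, expand_C, map_ofNat,
      expand_expand _ _ (by norm_num : (729 : ℕ) ≠ 0) (by norm_num) L,
      expand_expand _ _ (by norm_num : (243 : ℕ) ≠ 0) (by norm_num) L] at h
  have R9' : HasBoundedDenominators (3 * (expand 81 (by norm_num) L - PowerSeries.C tK * expand 27 (by norm_num) L +
      3 * expand 9 (by norm_num) L)) := by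
    have h := hbd_C_mul (3 : KNine) R9
    rwa [map_ofNat] at h
  rw [expand_expand _ _ (by norm_num : (81 : ℕ) ≠ 0) (by norm_num) L,
    expand_expand _ _ (by norm_num : (243 : ℕ) ≠ 0) (by norm_num) L,
    expand_expand _ _ (by norm_num : (243 : ℕ) ≠ 0) (by norm_num) L,
    expand_expand _ _ (by norm_num : (729 : ℕ) ≠ 0) (by norm_num) L]
  refine ⟨?_, ?_, ?_, ?_⟩
  · have e : expand 81 (by norm_num) L -
        (PowerSeries.C tK * expand 27 (by norm_num) L + PowerSeries.C (-3) * expand 9 (by norm_num) L) =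
        expand 81 (by norm_num) L - PowerSeries.C tK * expand 27 (by norm_num) L + 3 * expand 9 (by norm_num) L := by
      simp only [map_neg, map_ofNat]; ring
    rw [e]; exact R9
  · have e : expand 243 (by norm_num) L - (PowerSeries.C (tK ^ 2 - 3) * expand 27 (by norm_num) L +
        PowerSeries.C (-3 * tK) * expand 9 (by norm_num) L) =
        (expand 243 (by norm_num) L - PowerSeries.C tK * expand 81 (by norm_num) L + 3 * expand 27 (by norm_num) L) +
        PowerSeries.C tK * (expand 81 (by norm_num) L - PowerSeries.C tK * expand 27 (by norm_num) L +
          3 * expand 9 (by norm_num) L) := by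
      simp only [map_sub, map_mul, map_neg, map_pow, map_ofNat]; ring
    rw [e]; exact R27.add (hbd_C_mul _ R9)
  · have e : expand 243 (by norm_num) L - (PowerSeries.C (tK ^ 2 - 3) * expand 27 (by norm_num) L +
        PowerSeries.C (-3 * tK) * expand 9 (by norm_num) L) =
        (expand 243 (by norm_num) L - PowerSeries.C tK * expand 81 (by norm_num) L + 3 * expand 27 (by norm_num) L) +
        PowerSeries.C tK * (expand 81 (by norm_num) L - PowerSeries.C tK * expand 27 (by norm_num) L +
          3 * expand 9 (by norm_num) L) := by
      simp only [map_sub, map_mul, map_neg, map_pow, map_ofNat]; ring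
    rw [e]; exact R27.add (hbd_C_mul _ R9)
  · have e : expand 729 (by norm_num) L - (PowerSeries.C (tK ^ 3 - 6 * tK) * expand 27 (by norm_num) L +
        PowerSeries.C (9 - 3 * tK ^ 2) * expand 9 (by norm_num) L) =
        (expand 729 (by norm_num) L - PowerSeries.C tK * expand 243 (by norm_num) L + 3 * expand 81 (by norm_num) L) +
        PowerSeries.C tK * ((expand 243 (by norm_num) L - PowerSeries.C tK * expand 81 (by norm_num) L +
          3 * expand 27 (by norm_num) L) +
          PowerSeries.C tK * (expand 81 (by norm_num) L - PowerSeries.C tK * expand 27 (by norm_num) L +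
            3 * expand 9 (by norm_num) L)) -
        3 * (expand 81 (by norm_num) L - PowerSeries.C tK * expand 27 (by norm_num) L + 3 * expand 9 (by norm_num) L) := by
      simp only [map_sub, map_mul, map_pow, map_ofNat]; ring
    rw [e]
    exact (R81.add (hbd_C_mul _ (R27.add (hbd_C_mul _ R9)))).sub R9'

end Summit.BirchSwinnertonDyer.BirchSwinnertonDyer.Theorems.DescendedFrobeniusTransfer
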